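import Mathlib
import HarnessLib
import Summits.ValiantsHypothesis.ValiantsHypothesis.Theses.MonotoneRestoration
import Literature.Computability.AlgebraicComplexity.ArithCircuit
import Literature.Computability.AlgebraicComplexity.ArithCircuitProofs
import Literature.Computability.AlgebraicComplexity.MonotoneStructure
import Literature.Computability.AlgebraicComplexity.PermanentIrreducible
import Literature.ModelTheory.FiniteModelTheory.CkEquiv
import Summits.ValiantsHypothesis.ValiantsHypothesis.Theorems.MonotoneRestorationMonotoneRestorationQPCosetCount
import Summits.ValiantsHypothesis.ValiantsHypothesis.Theorems.MonotoneRestorationMonotoneRestorationQPSymmetricLB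
import Summits.ValiantsHypothesis.ValiantsHypothesis.Theorems.MonotoneRestorationMonotoneRestorationQPSupportSymmetrisation
import Summits.ValiantsHypothesis.ValiantsHypothesis.Theorems.MonotoneRestorationMonotoneRestorationQPSparseRegime
import Summits.ValiantsHypothesis.ValiantsHypothesis.Theorems.MonotoneRestorationMonotoneRestorationQPBeta
import Literature.Computability.AlgebraicComplexity.SymmetricArithCircuit
import Literature.Computability.AlgebraicComplexity.DawarWilsenach2025Proofs
import Literature.GroupTheory.PermutationGroups.SmallIndexSubgroups
import Summits.ValiantsHypothesis.ValiantsHypothesis.Theorems.MonotoneRestorationQP.Negative.LoadBearing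
import Summits.ValiantsHypothesis.ValiantsHypothesis.Theorems.MonotoneRestorationMonotoneRestorationQPPermSupportCount

/-! TTRL-lite variant V20773 of stmt-ValiantsHypothesis-15886 -/

namespace Summit.ValiantsHypothesis.ValiantsHypothesis.Theorems

open Summit.ValiantsHypothesis.ValiantsHypothesis.Theses.MonotoneRestoration
open Literature.Computability.AlgebraicComplexity

/-- TTRL-lite variant V20773 (`lemma_proposal`) of `stub_gammaArithmetic`
(stmt-ValiantsHypothesis-15886): the block parameter `k(c,n) = (log₂ n + c)^c + 2` is monotone
in `n`.  Proof: `Nat.log 2` is monotone (`Nat.log_mono_right`), so the base `log₂ m + c ≤ log₂ n + c`,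
and `x ↦ x ^ c` is monotone on `ℕ` (`Nat.pow_le_pow_left`). -/
theorem stub_gammaArithmetic_var20773 :
    ∀ (c m n : ℕ), m ≤ n → (Nat.log 2 m + c) ^ c + 2 ≤ (Nat.log 2 n + c) ^ c + 2 := by
  intro c m n h
  have h1 : Nat.log 2 m ≤ Nat.log 2 n := Nat.log_mono_right h
  have h2 : (Nat.log 2 m + c) ^ c ≤ (Nat.log 2 n + c) ^ c :=
    Nat.pow_le_pow_left (Nat.add_le_add_right h1 c) c
  exact Nat.add_le_add_right h2 2

end Summit.ValiantsHypothesis.ValiantsHypothesis.Theorems
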